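import Literature.MathematicalPhysics.QuantumFieldTheory.Balaban1983to89.B8LambdaSpaceKLevel

/-!
# `Balaban1983to89.B8LambdaSpaceKLevelOn` — [Balaban1985RegularSpaces] Sect. D p. 94: the contraction sentence for (1.100) on the space (1.102)
# RUN INSIDE A CLOSED INVARIANT SUBSET (the Ψ-bounds (1.98)∕(1.99)∕(1.106) assumed on that subset only), and its instance «`P`-periodic λ's»
# (sub-row «G-B8-T2S», RULING #4 v3, layer 3(a) of `lit-balaban-t2s-1/g2/V3-DESIGN.md`)

statement-level skeleton of published theorems with citation tags; proofs where landed; nothing here is a claim about the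
Yang–Mills mass gap

T. Bałaban, *Spaces of regular gauge field configurations on a lattice and gauge fixing conditions*, Commun. Math. Phys. **99** (1985) 75–102
`[Balaban1985RegularSpaces]` ("B8"): (1.100)–(1.103) p. 93, p. 94 («the transformation 𝔉 maps the domain (1.102) with β = ¼ into itself and is
contractive … there exists a unique fixed point»), (1.106) p. 94, p. 77 («Ω_j = T_η»: on the torus every configuration is periodic).  STATUS: published,
refereed.

CITATION HEADER (lean-in-tree rule).  Cell `lit-balaban`, seat `lit-balaban-t2s-1` (gen 2).  WHY.  `B8LambdaSpaceKLevel.fixedPoint_kLevel` runs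
print's contraction for `λ ↦ G′(Ψλ)` on the whole ¼α₄-ball of (1.102), with the size∕Lipschitz bounds of `Ψ` (`hΨ0`, `hΨ1`) assumed at EVERY `λ` of
the ball.  In the v3 torus run (RULING #4: [4]'s laws at `P`-periodic arguments only) `Ψ` — which contains Sect. E's `D′(u₁⁻¹, −iλ)` — is controlled at
PERIODIC `λ` only, while `G′ = G′∘π` (`B8Thm2TorusLettersPerConv.gH`) takes periodic values at every argument.  This file re-runs the SAME contraction
on a closed subset `S ∋ 0` of the space mapped into itself, with `hΨ0`∕`hΨ1` assumed on `S` only: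
* §1 `fixedPoint_closedBall_on` — Banach's theorem on `S ∩ (closed ρ-ball)` with the self-map and Lipschitz hypotheses on `S` only (r05's
  `B8SectDSource.fixedPoint_mem_of_invariant`, hypotheses relativised).
* §2 `fpMapKOn`, `fixedPoint_kLevel_on` — `B8LambdaSpaceKLevel.fixedPoint_kLevel` VERBATIM except: `hΨ0`, `hΨ1` for `s, t ∈ S`; the extra hypotheses
  `S` closed, `0 ∈ S`, `G′(Ψλ_s)`-elements lie in `S` for `s ∈ S`; conclusion: EXACTLY ONE fixed point in `S ∩ ball`; `fixedPoint_kLevel_on_selfAdjoint`.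
* §3 the instance `S = perSet P` («λ is `P`-periodic»): closed, contains `0`, invariant as soon as `G′` takes periodic values (`fixedPoint_kLevel_per`).

HONEST SCOPE.  Elementary (Banach fixed point); [4], (1.99), Sect. E NOT proved — displayed hypotheses as in the original; no engine above this file is
re-run here; count-neutral; N05 ∕ `stub_PV3A` NOT discharged; nothing continuum ∕ ℝ⁴ ∕ OS ∕ mass-gap ∕ Clay — the Yang–Mills mass gap is NOT proved.
No `sorry`, no `… : Prop` fact, no `instance`, no `notation`.
-/

noncomputable section

open NormedSpace Metric Set

namespace Literature.MathematicalPhysics.QuantumFieldTheory.Balaban1983to89.B8LambdaSpaceKLevelOn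

open B7Prop1Explicit
open B8Ineq132 (covDerivFwd)
open B8LambdaSpaceKLevel (wt lamSubK lamOf lamOf_zero lamOf_sub mkLam lamOf_mkLam norm_mkLam_le ext_of_lamOf norm_le_iff norm_sub_le_iff
  norm_lamOf_le saSet mem_saSet zero_mem_saSet isClosed_saSet)

-- `Site` alone could resolve to the torus sites of `Setup.lean`; re-export the `ℤ^d` sites of `B7Prop1Explicit`.
export B7Prop1Explicit (Site)

variable {d : ℕ}

/-! ## §1 Banach's theorem on a closed invariant subset of a closed ball, hypotheses on the subset only -/

section Banach

variable {E : Type*} [NormedAddCommGroup E]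

/-- **The contraction mapping theorem on `S ∩ {‖x‖ ≤ ρ}`** for a closed `S ∋ 0` mapped into itself, the self-map and Lipschitz estimates being
assumed ON `S` ONLY: exactly one fixed point in `S ∩ {‖x‖ ≤ ρ}`. [cite: Balaban1985RegularSpaces, p.94 (after (1.106)), (1.102) p.93] -/
theorem fixedPoint_closedBall_on [CompleteSpace E] (frF : E → E) {ρ κ : ℝ} (hρ : 0 ≤ ρ) (hκ0 : 0 ≤ κ) (hκ1 : κ < 1)
    (S : Set E) (hS : IsClosed S) (h0 : (0 : E) ∈ S) (hinv : ∀ x ∈ S, ‖x‖ ≤ ρ → frF x ∈ S)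
    (hmaps : ∀ x ∈ S, ‖x‖ ≤ ρ → ‖frF x‖ ≤ ρ)
    (hlip : ∀ x ∈ S, ∀ y ∈ S, ‖x‖ ≤ ρ → ‖y‖ ≤ ρ → ‖frF x - frF y‖ ≤ κ * ‖x - y‖) :
    ∃ x ∈ S, ‖x‖ ≤ ρ ∧ frF x = x ∧ ∀ y ∈ S, ‖y‖ ≤ ρ → frF y = y → y = x := by
  set D : Set E := S ∩ closedBall (0 : E) ρ with hD
  have hmapsD : MapsTo frF D D := by
    intro y hy
    rcases hy with ⟨hyS, hyB⟩
    rw [mem_closedBall_zero_iff] at hyB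
    exact ⟨hinv y hyS hyB, mem_closedBall_zero_iff.2 (hmaps y hyS hyB)⟩
  have hcontr : ContractingWith (Real.toNNReal κ) (hmapsD.restrict frF D D) := by
    refine ⟨Real.toNNReal_lt_one.2 hκ1, LipschitzWith.of_dist_le_mul fun y z => ?_⟩
    have h := hlip y y.2.1 z z.2.1 (mem_closedBall_zero_iff.1 y.2.2) (mem_closedBall_zero_iff.1 z.2.2)
    simp only [Subtype.dist_eq, dist_eq_norm, MapsTo.val_restrict_apply, Real.coe_toNNReal κ hκ0]
    exact h
  have hDc : IsComplete D := (hS.inter isClosed_closedBall).isComplete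
  obtain ⟨y, hymem, hyfix, -⟩ := hcontr.exists_fixedPoint' hDc hmapsD
    (show (0 : E) ∈ D from ⟨h0, mem_closedBall_self hρ⟩) (edist_ne_top _ _)
  have hyB : ‖y‖ ≤ ρ := mem_closedBall_zero_iff.1 hymem.2
  refine ⟨y, hymem.1, hyB, hyfix.eq, fun z hzS hzB hzfix => ?_⟩
  have h := hlip z hzS y hymem.1 hzB hyB
  rw [hzfix, hyfix.eq] at h
  have hn : ‖z - y‖ = 0 := by nlinarith [norm_nonneg (z - y)]
  exact sub_eq_zero.1 (norm_eq_zero.1 hn)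

end Banach

/-! ## §2 The contraction sentence of p. 94 inside a closed invariant subset of the space (1.102) -/

section Contraction

variable {𝔸 : Type*} [NormedRing 𝔸] [NormedAlgebra ℂ 𝔸]
variable {η : ℝ} {U₀ : Site d → Fin d → 𝔸ˣ} {L k : ℕ} {Eb : ℕ → Set (Site d × Fin d)}

open Classical in
/-- The fixed-point map `𝔉 = G′ ∘ Ψ` of (1.100) as a self-map of (1.102), DEFINED THROUGH the subset `S`: on `S ∩ (¼α₄-ball)`
`s ↦ (G′(Ψλ_s), weighted gradients)`, `0` elsewhere (never used). [cite: Balaban1985RegularSpaces, (1.100)–(1.101) p.93] -/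
def fpMapKOn (hη : 0 ≤ η) (Ω : ℕ → Set (Site d)) (S : Set (lamSubK η U₀ L k Eb)) (Gp Ψ : (Site d → 𝔸) → (Site d → 𝔸)) (α₄ B₀' M : ℝ)
    (hG : ∀ (f : Site d → 𝔸) (m : ℝ), 0 ≤ m → (∀ j, j ≤ k → ∀ x ∈ Ω j, wt L η j ^ 2 * ‖f x‖ ≤ m) →
      (∀ x, ‖Gp f x‖ ≤ B₀' * m) ∧ ∀ j, j ≤ k → ∀ p ∈ Eb j, wt L η j * ‖covDerivFwd η U₀ p.2 (Gp f) p.1‖ ≤ B₀' * m)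
    (hM : 0 ≤ M)
    (hΨ0 : ∀ s : lamSubK η U₀ L k Eb, s ∈ S → ‖s‖ ≤ α₄ / 4 → ∀ j, j ≤ k → ∀ x ∈ Ω j, wt L η j ^ 2 * ‖Ψ (lamOf s) x‖ ≤ M)
    (s : lamSubK η U₀ L k Eb) : lamSubK η U₀ L k Eb :=
  if hs : s ∈ S ∧ ‖s‖ ≤ α₄ / 4 then
    mkLam hη (Gp (Ψ (lamOf s))) (hG (Ψ (lamOf s)) M hM (hΨ0 s hs.1 hs.2)).1 (hG (Ψ (lamOf s)) M hM (hΨ0 s hs.1 hs.2)).2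
  else 0

/-- On `S ∩ ball` the λ-component of `𝔉 s` is `G′(Ψ λ_s)`. [cite: Balaban1985RegularSpaces, (1.100) p.93] -/
theorem lamOf_fpMapKOn (hη : 0 ≤ η) (Ω : ℕ → Set (Site d)) (S : Set (lamSubK η U₀ L k Eb)) (Gp Ψ : (Site d → 𝔸) → (Site d → 𝔸))
    (α₄ B₀' M : ℝ)
    (hG : ∀ (f : Site d → 𝔸) (m : ℝ), 0 ≤ m → (∀ j, j ≤ k → ∀ x ∈ Ω j, wt L η j ^ 2 * ‖f x‖ ≤ m) →
      (∀ x, ‖Gp f x‖ ≤ B₀' * m) ∧ ∀ j, j ≤ k → ∀ p ∈ Eb j, wt L η j * ‖covDerivFwd η U₀ p.2 (Gp f) p.1‖ ≤ B₀' * m)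
    (hM : 0 ≤ M)
    (hΨ0 : ∀ s : lamSubK η U₀ L k Eb, s ∈ S → ‖s‖ ≤ α₄ / 4 → ∀ j, j ≤ k → ∀ x ∈ Ω j, wt L η j ^ 2 * ‖Ψ (lamOf s) x‖ ≤ M)
    {s : lamSubK η U₀ L k Eb} (hsS : s ∈ S) (hs : ‖s‖ ≤ α₄ / 4) :
    lamOf (fpMapKOn hη Ω S Gp Ψ α₄ B₀' M hG hM hΨ0 s) = Gp (Ψ (lamOf s)) := by
  rw [fpMapKOn, dif_pos ⟨hsS, hs⟩, lamOf_mkLam]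

/-- On `S ∩ ball`, `‖𝔉 s‖ ≤ B′₀M`. [cite: Balaban1985RegularSpaces, (1.101)–(1.103) p.93] -/
theorem norm_fpMapKOn_le (hη : 0 ≤ η) (Ω : ℕ → Set (Site d)) (S : Set (lamSubK η U₀ L k Eb)) (Gp Ψ : (Site d → 𝔸) → (Site d → 𝔸))
    (α₄ B₀' M : ℝ)
    (hG : ∀ (f : Site d → 𝔸) (m : ℝ), 0 ≤ m → (∀ j, j ≤ k → ∀ x ∈ Ω j, wt L η j ^ 2 * ‖f x‖ ≤ m) →
      (∀ x, ‖Gp f x‖ ≤ B₀' * m) ∧ ∀ j, j ≤ k → ∀ p ∈ Eb j, wt L η j * ‖covDerivFwd η U₀ p.2 (Gp f) p.1‖ ≤ B₀' * m)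
    (hM : 0 ≤ M)
    (hΨ0 : ∀ s : lamSubK η U₀ L k Eb, s ∈ S → ‖s‖ ≤ α₄ / 4 → ∀ j, j ≤ k → ∀ x ∈ Ω j, wt L η j ^ 2 * ‖Ψ (lamOf s) x‖ ≤ M)
    {s : lamSubK η U₀ L k Eb} (hsS : s ∈ S) (hs : ‖s‖ ≤ α₄ / 4) :
    ‖fpMapKOn hη Ω S Gp Ψ α₄ B₀' M hG hM hΨ0 s‖ ≤ B₀' * M := by
  rw [fpMapKOn, dif_pos ⟨hsS, hs⟩]
  exact (norm_mkLam_le hη _ _ _).trans (max_le le_rfl le_rfl)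

variable [CompleteSpace 𝔸]

/-- **THE CONTRACTION SENTENCE OF p. 94 ON THE SPACE (1.102), RUN INSIDE A CLOSED INVARIANT SUBSET `S`** — `B8LambdaSpaceKLevel.fixedPoint_kLevel`
VERBATIM except that the `(−2)`-weighted size `M` ((1.98)R + (1.99)) and the Lipschitz modulus `K` ((1.106)) of `Ψ` are assumed for `s, t ∈ S` only,
where `S ∋ 0` is a closed subset of (1.102) such that the element `(G′(Ψλ_s), gradients)` lies in `S` for `s ∈ S ∩ ball` (`hinv`); `G′` with the
(1.101)-shape bound at every argument (`hG`) and additive.  Conclusion: there is EXACTLY ONE `s ∈ S` with `‖s‖ ≤ ¼α₄` and `λ_s = G′(Ψ λ_s)`.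
[cite: Balaban1985RegularSpaces, p.94 (after (1.106)), (1.100)–(1.103) p.93, (1.106) p.94] -/
theorem fixedPoint_kLevel_on (hη : 0 ≤ η) (Ω : ℕ → Set (Site d)) (S : Set (lamSubK η U₀ L k Eb)) (hS : IsClosed S) (h0 : (0 : lamSubK η U₀ L k Eb) ∈ S)
    (Gp Ψ : (Site d → 𝔸) → (Site d → 𝔸)) {α₄ B₀' M K : ℝ} (hα₄ : 0 ≤ α₄) (hB : 0 ≤ B₀') (hM : 0 ≤ M) (hK : 0 ≤ K)
    (hG : ∀ (f : Site d → 𝔸) (m : ℝ), 0 ≤ m → (∀ j, j ≤ k → ∀ x ∈ Ω j, wt L η j ^ 2 * ‖f x‖ ≤ m) →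
      (∀ x, ‖Gp f x‖ ≤ B₀' * m) ∧ ∀ j, j ≤ k → ∀ p ∈ Eb j, wt L η j * ‖covDerivFwd η U₀ p.2 (Gp f) p.1‖ ≤ B₀' * m)
    (hGsub : ∀ f g : Site d → 𝔸, Gp (f - g) = Gp f - Gp g)
    (hΨ0 : ∀ s : lamSubK η U₀ L k Eb, s ∈ S → ‖s‖ ≤ α₄ / 4 → ∀ j, j ≤ k → ∀ x ∈ Ω j, wt L η j ^ 2 * ‖Ψ (lamOf s) x‖ ≤ M)
    (hΨ1 : ∀ s t : lamSubK η U₀ L k Eb, s ∈ S → t ∈ S → ‖s‖ ≤ α₄ / 4 → ‖t‖ ≤ α₄ / 4 →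
      ∀ j, j ≤ k → ∀ x ∈ Ω j, wt L η j ^ 2 * ‖Ψ (lamOf s) x - Ψ (lamOf t) x‖ ≤ K * ‖s - t‖)
    (hinv : ∀ s : lamSubK η U₀ L k Eb, s ∈ S → ‖s‖ ≤ α₄ / 4 → ∀ t : lamSubK η U₀ L k Eb, lamOf t = Gp (Ψ (lamOf s)) → t ∈ S)
    (h103 : B₀' * M ≤ α₄ / 4) (h106 : B₀' * K ≤ 1 / 2) :
    ∃ s : lamSubK η U₀ L k Eb, s ∈ S ∧ ‖s‖ ≤ α₄ / 4 ∧ lamOf s = Gp (Ψ (lamOf s)) ∧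
      ∀ t : lamSubK η U₀ L k Eb, t ∈ S → ‖t‖ ≤ α₄ / 4 → lamOf t = Gp (Ψ (lamOf t)) → t = s := by
  set T := fpMapKOn hη Ω S Gp Ψ α₄ B₀' M hG hM hΨ0 with hT
  -- `T` maps `S ∩ ball` into `S`
  have hinvT : ∀ s ∈ S, ‖s‖ ≤ α₄ / 4 → T s ∈ S := fun s hsS hs =>
    hinv s hsS hs (T s) (by rw [hT, lamOf_fpMapKOn hη Ω S Gp Ψ α₄ B₀' M hG hM hΨ0 hsS hs])
  -- self-map of the closed ball, on `S`
  have hmaps : ∀ s ∈ S, ‖s‖ ≤ α₄ / 4 → ‖T s‖ ≤ α₄ / 4 := fun s hsS hs =>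
    (norm_fpMapKOn_le hη Ω S Gp Ψ α₄ B₀' M hG hM hΨ0 hsS hs).trans h103
  -- Lipschitz with constant `B′₀K ≤ ½`, on `S`
  have hlip : ∀ s ∈ S, ∀ t ∈ S, ‖s‖ ≤ α₄ / 4 → ‖t‖ ≤ α₄ / 4 → ‖T s - T t‖ ≤ B₀' * K * ‖s - t‖ := by
    intro s hsS t htS hs ht
    have hm : 0 ≤ K * ‖s - t‖ := by positivity
    have hdiff : ∀ j, j ≤ k → ∀ x ∈ Ω j, wt L η j ^ 2 * ‖(Ψ (lamOf s) - Ψ (lamOf t)) x‖ ≤ K * ‖s - t‖ := fun j hj x hx => by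
      simpa only [Pi.sub_apply] using hΨ1 s t hsS htS hs ht j hj x hx
    obtain ⟨h0', h1⟩ := hG (Ψ (lamOf s) - Ψ (lamOf t)) (K * ‖s - t‖) hm hdiff
    rw [show B₀' * K * ‖s - t‖ = B₀' * (K * ‖s - t‖) by ring]
    refine (norm_sub_le_iff hη (T s) (T t) (by positivity)).2 ⟨fun x => ?_, fun j hj p hp => ?_⟩
    · rw [hT, lamOf_fpMapKOn hη Ω S Gp Ψ α₄ B₀' M hG hM hΨ0 hsS hs, lamOf_fpMapKOn hη Ω S Gp Ψ α₄ B₀' M hG hM hΨ0 htS ht, ← Pi.sub_apply,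
        ← hGsub]
      exact h0' x
    · rw [hT, lamOf_fpMapKOn hη Ω S Gp Ψ α₄ B₀' M hG hM hΨ0 hsS hs, lamOf_fpMapKOn hη Ω S Gp Ψ α₄ B₀' M hG hM hΨ0 htS ht, ← hGsub]
      exact h1 j hj p hp
  have hκ1 : B₀' * K < 1 := by linarith
  obtain ⟨s, hsS, hs, hfix, huniq⟩ := fixedPoint_closedBall_on T (by positivity) (by positivity) hκ1 S hS h0 hinvT hmaps hlip
  refine ⟨s, hsS, hs, ?_, fun t htS ht htfix => huniq t htS ht ?_⟩
  · have h := congrArg lamOf hfix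
    rwa [hT, lamOf_fpMapKOn hη Ω S Gp Ψ α₄ B₀' M hG hM hΨ0 hsS hs, eq_comm] at h
  · apply ext_of_lamOf
    rw [hT, lamOf_fpMapKOn hη Ω S Gp Ψ α₄ B₀' M hG hM hΨ0 htS ht]
    exact htfix.symm

/-- **The fixed point in `S` is a REAL configuration** when `G′ ∘ Ψ` preserves real configurations on `S` (p. 93): run the same contraction in
the closed invariant subset `S ∩ saSet` and use uniqueness in `S`. [cite: Balaban1985RegularSpaces, p.93 (after (1.102)), (1.100) p.93] -/
theorem fixedPoint_kLevel_on_selfAdjoint [StarRing 𝔸] [ContinuousStar 𝔸] (hη : 0 ≤ η) (Ω : ℕ → Set (Site d)) (S : Set (lamSubK η U₀ L k Eb))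
    (hS : IsClosed S) (h0 : (0 : lamSubK η U₀ L k Eb) ∈ S)
    (Gp Ψ : (Site d → 𝔸) → (Site d → 𝔸)) {α₄ B₀' M K : ℝ} (hα₄ : 0 ≤ α₄) (hB : 0 ≤ B₀') (hM : 0 ≤ M) (hK : 0 ≤ K)
    (hG : ∀ (f : Site d → 𝔸) (m : ℝ), 0 ≤ m → (∀ j, j ≤ k → ∀ x ∈ Ω j, wt L η j ^ 2 * ‖f x‖ ≤ m) →
      (∀ x, ‖Gp f x‖ ≤ B₀' * m) ∧ ∀ j, j ≤ k → ∀ p ∈ Eb j, wt L η j * ‖covDerivFwd η U₀ p.2 (Gp f) p.1‖ ≤ B₀' * m)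
    (hGsub : ∀ f g : Site d → 𝔸, Gp (f - g) = Gp f - Gp g)
    (hΨ0 : ∀ s : lamSubK η U₀ L k Eb, s ∈ S → ‖s‖ ≤ α₄ / 4 → ∀ j, j ≤ k → ∀ x ∈ Ω j, wt L η j ^ 2 * ‖Ψ (lamOf s) x‖ ≤ M)
    (hΨ1 : ∀ s t : lamSubK η U₀ L k Eb, s ∈ S → t ∈ S → ‖s‖ ≤ α₄ / 4 → ‖t‖ ≤ α₄ / 4 →
      ∀ j, j ≤ k → ∀ x ∈ Ω j, wt L η j ^ 2 * ‖Ψ (lamOf s) x - Ψ (lamOf t) x‖ ≤ K * ‖s - t‖)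
    (hinv : ∀ s : lamSubK η U₀ L k Eb, s ∈ S → ‖s‖ ≤ α₄ / 4 → ∀ t : lamSubK η U₀ L k Eb, lamOf t = Gp (Ψ (lamOf s)) → t ∈ S)
    (h103 : B₀' * M ≤ α₄ / 4) (h106 : B₀' * K ≤ 1 / 2)
    (hreal : ∀ s : lamSubK η U₀ L k Eb, s ∈ S → ‖s‖ ≤ α₄ / 4 → (∀ x, IsSelfAdjoint (lamOf s x)) → ∀ x, IsSelfAdjoint (Gp (Ψ (lamOf s)) x))
    {s : lamSubK η U₀ L k Eb} (hsS : s ∈ S) (hs : ‖s‖ ≤ α₄ / 4) (hfix : lamOf s = Gp (Ψ (lamOf s))) :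
    ∀ x, IsSelfAdjoint (lamOf s x) := by
  -- the contraction inside the smaller closed invariant subset `S ∩ saSet`
  set S' : Set (lamSubK η U₀ L k Eb) := S ∩ saSet η U₀ L k Eb with hS'
  have hS'c : IsClosed S' := hS.inter isClosed_saSet
  have h0' : (0 : lamSubK η U₀ L k Eb) ∈ S' := ⟨h0, zero_mem_saSet⟩
  obtain ⟨s', hs'S, hs', hfix', -⟩ := fixedPoint_kLevel_on hη Ω S' hS'c h0' Gp Ψ hα₄ hB hM hK hG hGsub
    (fun s hsS hs => hΨ0 s hsS.1 hs) (fun s t hsS htS hs ht => hΨ1 s t hsS.1 htS.1 hs ht)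
    (fun s hsS hs t ht => ⟨hinv s hsS.1 hs t ht, fun x => by rw [ht]; exact hreal s hsS.1 hs hsS.2 x⟩) h103 h106
  -- uniqueness in `S` identifies `s` with `s' ∈ saSet`
  obtain ⟨s₀, -, -, -, huniq⟩ := fixedPoint_kLevel_on hη Ω S hS h0 Gp Ψ hα₄ hB hM hK hG hGsub hΨ0 hΨ1 hinv h103 h106
  have h1 : s = s₀ := huniq s hsS hs hfix
  have h2 : s' = s₀ := huniq s' hs'S.1 hs' hfix'
  rw [h1, ← h2]
  exact hs'S.2

end Contraction

/-! ## §3 The instance «λ is `P`-periodic» (p. 77: `Ω_j = T_η`) -/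

section Periodic

variable {𝔸 : Type*} [NormedRing 𝔸] [NormedAlgebra ℂ 𝔸]
variable {η : ℝ} {U₀ : Site d → Fin d → 𝔸ˣ} {L k : ℕ} {Eb : ℕ → Set (Site d × Fin d)}

variable (η U₀ L k Eb) in
/-- The elements of (1.102) whose λ-component is `P`-PERIODIC (`λ(x + P•eᵢ) = λ(x)`): the configurations of the torus of side `P` read on `ℤᵈ`.
[cite: Balaban1985RegularSpaces, p.77 («Ω_j = T_η»), (1.102) p.93] -/
def perSet (P : ℤ) : Set (lamSubK η U₀ L k Eb) := {s | ∀ (z : Site d) (i : Fin d), lamOf s (z + P • e i) = lamOf s z}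

/-- Membership, unfolded. [cite: Balaban1985RegularSpaces, p.77] -/
theorem mem_perSet {P : ℤ} {s : lamSubK η U₀ L k Eb} : s ∈ perSet η U₀ L k Eb P ↔ ∀ (z : Site d) (i : Fin d), lamOf s (z + P • e i) = lamOf s z :=
  Iff.rfl

/-- `0` is periodic. [cite: Balaban1985RegularSpaces, p.77] -/
theorem zero_mem_perSet (P : ℤ) : (0 : lamSubK η U₀ L k Eb) ∈ perSet η U₀ L k Eb P := fun z i => by
  rw [lamOf_zero, Pi.zero_apply, Pi.zero_apply]

/-- The periodic elements form a CLOSED subset (evaluation is continuous). [cite: Balaban1985RegularSpaces, p.77, (1.102) p.93] -/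
theorem isClosed_perSet (P : ℤ) : IsClosed (perSet η U₀ L k Eb P) := by
  have : perSet η U₀ L k Eb P = ⋂ z : Site d, ⋂ i : Fin d, {s : lamSubK η U₀ L k Eb | lamOf s (z + P • e i) = lamOf s z} := by
    ext s; simp [perSet]
  rw [this]
  refine isClosed_iInter fun z => isClosed_iInter fun i => ?_
  have hev : ∀ x : Site d, Continuous fun s : lamSubK η U₀ L k Eb => lamOf s x := fun x =>
    (ContinuousEvalConst.continuous_eval_const (Sum.inl x)).comp continuous_subtype_val
  exact isClosed_eq (hev _) (hev _)

variable [CompleteSpace 𝔸]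

/-- **THE CONTRACTION SENTENCE OF p. 94 ON THE `P`-PERIODIC CONFIGURATIONS OF (1.102)** (the torus run of RULING #4 v3): for a letter `G′` with
the (1.101)-shape bound at every argument, additive, and with `P`-PERIODIC VALUES AT EVERY ARGUMENT (`hGper`; e.g. `G′∘π` of
`B8Thm2TorusLettersPerConv`), and a nonlinearity `Ψ` whose size `M` and Lipschitz modulus `K` are known AT PERIODIC `λ` ONLY, under `B′₀M ≤ ¼α₄`,
`B′₀K ≤ ½`: there is EXACTLY ONE `P`-periodic `s` with `‖s‖ ≤ ¼α₄` and `λ_s = G′(Ψλ_s)`.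
[cite: Balaban1985RegularSpaces, p.94 (after (1.106)), (1.100)–(1.103) p.93, p.77 («Ω_j = T_η»)] -/
theorem fixedPoint_kLevel_per (hη : 0 ≤ η) (Ω : ℕ → Set (Site d)) (P : ℤ) (Gp Ψ : (Site d → 𝔸) → (Site d → 𝔸)) {α₄ B₀' M K : ℝ}
    (hα₄ : 0 ≤ α₄) (hB : 0 ≤ B₀') (hM : 0 ≤ M) (hK : 0 ≤ K)
    (hG : ∀ (f : Site d → 𝔸) (m : ℝ), 0 ≤ m → (∀ j, j ≤ k → ∀ x ∈ Ω j, wt L η j ^ 2 * ‖f x‖ ≤ m) →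
      (∀ x, ‖Gp f x‖ ≤ B₀' * m) ∧ ∀ j, j ≤ k → ∀ p ∈ Eb j, wt L η j * ‖covDerivFwd η U₀ p.2 (Gp f) p.1‖ ≤ B₀' * m)
    (hGsub : ∀ f g : Site d → 𝔸, Gp (f - g) = Gp f - Gp g)
    (hGper : ∀ (f : Site d → 𝔸) (z : Site d) (i : Fin d), Gp f (z + P • e i) = Gp f z)
    (hΨ0 : ∀ s : lamSubK η U₀ L k Eb, (∀ (z : Site d) (i : Fin d), lamOf s (z + P • e i) = lamOf s z) → ‖s‖ ≤ α₄ / 4 →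
      ∀ j, j ≤ k → ∀ x ∈ Ω j, wt L η j ^ 2 * ‖Ψ (lamOf s) x‖ ≤ M)
    (hΨ1 : ∀ s t : lamSubK η U₀ L k Eb, (∀ (z : Site d) (i : Fin d), lamOf s (z + P • e i) = lamOf s z) →
      (∀ (z : Site d) (i : Fin d), lamOf t (z + P • e i) = lamOf t z) → ‖s‖ ≤ α₄ / 4 → ‖t‖ ≤ α₄ / 4 →
      ∀ j, j ≤ k → ∀ x ∈ Ω j, wt L η j ^ 2 * ‖Ψ (lamOf s) x - Ψ (lamOf t) x‖ ≤ K * ‖s - t‖)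
    (h103 : B₀' * M ≤ α₄ / 4) (h106 : B₀' * K ≤ 1 / 2) :
    ∃ s : lamSubK η U₀ L k Eb, (∀ (z : Site d) (i : Fin d), lamOf s (z + P • e i) = lamOf s z) ∧ ‖s‖ ≤ α₄ / 4 ∧
      lamOf s = Gp (Ψ (lamOf s)) ∧
      ∀ t : lamSubK η U₀ L k Eb, (∀ (z : Site d) (i : Fin d), lamOf t (z + P • e i) = lamOf t z) → ‖t‖ ≤ α₄ / 4 →
        lamOf t = Gp (Ψ (lamOf t)) → t = s := by
  obtain ⟨s, hsS, hs, hfix, huniq⟩ := fixedPoint_kLevel_on hη Ω (perSet η U₀ L k Eb P) (isClosed_perSet P) (zero_mem_perSet P) Gp Ψ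
    hα₄ hB hM hK hG hGsub (fun s hsS hs => hΨ0 s hsS hs) (fun s t hsS htS hs ht => hΨ1 s t hsS htS hs ht)
    (fun s _ _ t ht z i => by rw [ht]; exact hGper _ z i) h103 h106
  exact ⟨s, hsS, hs, hfix, fun t htS ht htfix => huniq t htS ht htfix⟩

/-- … and that fixed point is a REAL configuration when `G′ ∘ Ψ` preserves reality at periodic `λ`. [cite: Balaban1985RegularSpaces, p.93 (after (1.102)), p.77] -/
theorem fixedPoint_kLevel_per_selfAdjoint [StarRing 𝔸] [ContinuousStar 𝔸] (hη : 0 ≤ η) (Ω : ℕ → Set (Site d)) (P : ℤ)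
    (Gp Ψ : (Site d → 𝔸) → (Site d → 𝔸)) {α₄ B₀' M K : ℝ} (hα₄ : 0 ≤ α₄) (hB : 0 ≤ B₀') (hM : 0 ≤ M) (hK : 0 ≤ K)
    (hG : ∀ (f : Site d → 𝔸) (m : ℝ), 0 ≤ m → (∀ j, j ≤ k → ∀ x ∈ Ω j, wt L η j ^ 2 * ‖f x‖ ≤ m) →
      (∀ x, ‖Gp f x‖ ≤ B₀' * m) ∧ ∀ j, j ≤ k → ∀ p ∈ Eb j, wt L η j * ‖covDerivFwd η U₀ p.2 (Gp f) p.1‖ ≤ B₀' * m)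
    (hGsub : ∀ f g : Site d → 𝔸, Gp (f - g) = Gp f - Gp g)
    (hGper : ∀ (f : Site d → 𝔸) (z : Site d) (i : Fin d), Gp f (z + P • e i) = Gp f z)
    (hΨ0 : ∀ s : lamSubK η U₀ L k Eb, (∀ (z : Site d) (i : Fin d), lamOf s (z + P • e i) = lamOf s z) → ‖s‖ ≤ α₄ / 4 →
      ∀ j, j ≤ k → ∀ x ∈ Ω j, wt L η j ^ 2 * ‖Ψ (lamOf s) x‖ ≤ M)
    (hΨ1 : ∀ s t : lamSubK η U₀ L k Eb, (∀ (z : Site d) (i : Fin d), lamOf s (z + P • e i) = lamOf s z) →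
      (∀ (z : Site d) (i : Fin d), lamOf t (z + P • e i) = lamOf t z) → ‖s‖ ≤ α₄ / 4 → ‖t‖ ≤ α₄ / 4 →
      ∀ j, j ≤ k → ∀ x ∈ Ω j, wt L η j ^ 2 * ‖Ψ (lamOf s) x - Ψ (lamOf t) x‖ ≤ K * ‖s - t‖)
    (h103 : B₀' * M ≤ α₄ / 4) (h106 : B₀' * K ≤ 1 / 2)
    (hreal : ∀ s : lamSubK η U₀ L k Eb, (∀ (z : Site d) (i : Fin d), lamOf s (z + P • e i) = lamOf s z) → ‖s‖ ≤ α₄ / 4 →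
      (∀ x, IsSelfAdjoint (lamOf s x)) → ∀ x, IsSelfAdjoint (Gp (Ψ (lamOf s)) x))
    {s : lamSubK η U₀ L k Eb} (hsP : ∀ (z : Site d) (i : Fin d), lamOf s (z + P • e i) = lamOf s z) (hs : ‖s‖ ≤ α₄ / 4)
    (hfix : lamOf s = Gp (Ψ (lamOf s))) : ∀ x, IsSelfAdjoint (lamOf s x) :=
  fixedPoint_kLevel_on_selfAdjoint hη Ω (perSet η U₀ L k Eb P) (isClosed_perSet P) (zero_mem_perSet P) Gp Ψ hα₄ hB hM hK hG hGsub
    (fun s hsS hs => hΨ0 s hsS hs) (fun s t hsS htS hs ht => hΨ1 s t hsS htS hs ht) (fun s _ _ t ht z i => by rw [ht]; exact hGper _ z i)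
    h103 h106 (fun s hsS hs hsa => hreal s hsS hs hsa) hsP hs hfix

end Periodic

#print axioms fixedPoint_closedBall_on
#print axioms fixedPoint_kLevel_on
#print axioms fixedPoint_kLevel_on_selfAdjoint
#print axioms fixedPoint_kLevel_per

end Literature.MathematicalPhysics.QuantumFieldTheory.Balaban1983to89.B8LambdaSpaceKLevelOn

end
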